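import Literature.Analysis.Complex.HolomorphicIntoLinfty
import Summits.QuantumFields.BalabanUV.T4Continuum.Support.B13OpDatum

/-!
# Spine/NE5/SeamFromEntrywise — the (T3)-seam of the D4 ↔ NE5 junction in the PRINTED currency (ENTRYWISE holomorphy of the
# step's data with entrywise-uniform weighted bounds suffices) and the format-level interpolation behind residual (r4) (cell `pub-balaban-gaps`, YM blitz Y1, track G2, seat `ne5` gen 3)

Companion of `Spine/NE5/StepObjectFromActivities` (p343082; the junction NE5 ⟹ D4: NE5's H-layer datum `hH` + a seam `s : Wn → Φ` whose DATA IMAGE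
`v ↦ dat (s v)` is ℂ-differentiable INTO `Op × Hist` ⟹ row D4's `StepObjectD4` inputs) and of `Literature/Analysis/Complex/HolomorphicIntoLinfty`
(Mujica 1986 Ex. 8.H in Mathlib vocabulary: coordinatewise holomorphic + bounded ⟹ holomorphic into `ℓ^∞` ∕ into `α →ᵇ F`) and of
`Support/B13OpDatum` (NE5 leaf-07: `OpDatum`, `Format`, `assemble`, `InFormat`).

WHY.  Row NE5's data spaces of record are SUP-NORMED COORDINATE SPACES: the operator datum `B13OpDatum.OpDatum E := lp (fun _ : E => ℂ) ∞`
(normalised weighted kernel entries, [II] (1.7) ∕ (2.16) formats) and the history datum `B13HistDatum.Hist F := BoundedContinuousFunction (Entry F) ℂ`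
((1.36) ∕ (1.43)-weighted potential tables).  What print gives for Bałaban's operators as functions of the complex background is ENTRYWISE
analyticity with bounds uniform on the complex domain ([B9] Thm 3.4 p. 400 *«the operators … extend to configurations U′U … as analytic functions
of A»*; [II] (1.5) ∕ (1.7) p. 3), and what the tree wires is entrywise too (`Support/NE9ChartFaceOperatorHolo` §2–§4, whose header lists
«analyticity of the ASSEMBLED `OpDatum`-valued map» as NOT HERE).  The junction's hypothesis `hs` asks for the ASSEMBLED map.  This file closes
the gap between the two currencies (triage sheet `HOME/ne/NE5.md` v3 §7 (r5)):
* §1 `differentiableOn_seam_of_entrywise` — a seam into `lp (fun _ : E₁ => ℂ) ∞ × (E₂ →ᵇ ℂ)` whose operator entries and history entries are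
  each ℂ-differentiable on the α₂-ball with entrywise-uniform bounds is ℂ-differentiable on the α₂-ball INTO the product of the sup-normed
  spaces (`HolomorphicIntoLinfty.differentiableOn_of_forall_coord_le` ∕ `differentiableOn_bcf_of_forall_coord_le` + `DifferentiableOn.prodMk`);
  (the composition with `StepObjectFromActivities.differentiableOn_H_at_of_hH` — NE5's `hH` + an entrywise seam ⟹ row D4's activity-holomorphy
  leaf — is then ONE application; it is filed next to that file once it has landed, p343082);
* §2 `differentiableOn_assemble_of_entrywise` — row NE9's instancer currency: the NORMALISED datum `v ↦ B13OpDatum.assemble F (K v)` of a raw kernel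
  whose entries are ℂ-differentiable on an open parameter set and which stays in the format ball `InFormat F (K v) R` there (the one-run bound
  holding uniformly on the complex domain) is ℂ-differentiable INTO `OpDatum E₁` — the «assembled map» item of `NE9ChartFaceOperatorHolo`;
* §3 `inFormat_sub_interpolate` ∕ `norm_assemble_sub_le_interpolate` — residual (r4) of `HOME/ne/NE5.md` §7 (the NORM JUNCTION W1 → W2) in kernel at
  the format level: an UNWEIGHTED entrywise two-run rate `r` (what an operator-norm two-spacing rate gives) and the WEIGHTED one-run format bounds
  `R` of both runs interpolate to the two-run bound `r^{1−s}(2R)^s` in any format dominating the `s`-th powers of the weights (rate `θ^{(1−s)j}`,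
  decay `e^{−sδd}`: harmless in kind — [II] then wants a larger cube size M, p. 16 «e^{−⅓δ₀M}e^{16κ₁} < 1»).  Pure `min a b ≤ a^{1−s}b^s`.

HONEST FRAMING.  Bookkeeping by composition; `act`, `dat`, the seam and every bound are HYPOTHESES; nothing of Bałaban's is constructed or asserted;
NE5 NOT PRINTED ∕ NOT PROVED, (D4) NOT discharged, NODE O instance 0∕1; 0∕12 NE5 leaves on Bałaban's objects.  Rung (B)+1 on a FIXED finite T⁴ —
NOT continuum by itself, NOT infinite volume, NOT mass gap, NOT Clay.  Spine PROVED 0∕9.  HONEST DEPENDENCY: continuum YM on T⁴ ⇐ BetaPertH ∧ nine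
spine estimates; BetaPertH ⇐ (D1) ∧ (D4) ∧ CAP+tail.  0 sorry, 0 def (one private arithmetic helper).
-/

noncomputable section

namespace Summit.QuantumFields.BalabanUV.T4Continuum.Spine.NE5

open Set Metric
open scoped ENNReal
open Literature.Analysis.Complex.HolomorphicIntoLinfty

/-! ## §1 The (T3)-seam in NE5's sup-normed data spaces from ENTRYWISE holomorphy -/

section Seam

variable {E₁ : Type*} {E₂ : Type*} [TopologicalSpace E₂] [DiscreteTopology E₂]
variable {Wn : Type*} [NormedAddCommGroup Wn] [NormedSpace ℂ Wn]

/-- **THE DATA SEAM IS HOLOMORPHIC INTO `OpDatum × Hist` AS SOON AS IT IS ENTRYWISE HOLOMORPHIC WITH UNIFORM BOUNDS.**  For data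
spaces of NE5's record kind — operators as normalised weighted entries `lp (fun _ : E₁ => ℂ) ∞` (`B13OpDatum.OpDatum E₁`) and
potentials ∕ history as bounded tables `E₂ →ᵇ ℂ` on a discrete entry type (`B13HistDatum.Hist`) — a seam `v ↦ dat (s v)` whose
operator ENTRIES and history ENTRIES are each complex-differentiable on the α₂-ball, with entrywise-uniform bounds `B₁`, `B₂` there
(print's currency: [B9] Thm 3.4 «extend … as analytic functions of A» with the (1.7)-type bounds holding on the complex domain), IS
complex-differentiable on the α₂-ball as a map into the product of the two sup-normed spaces — the hypothesis `hs` of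
`StepObjectFromActivities.differentiableOn_H_of_activities` ∕ `differentiableOn_H_at_of_hH`.  By Mujica 1986 Ex. 8.H in the tree's
form (`HolomorphicIntoLinfty.differentiableOn_of_forall_coord_le` ∕ `differentiableOn_bcf_of_forall_coord_le`) and `DifferentiableOn.prod`.
[cite: Mujica1986, Ex. 8.H] -/
theorem differentiableOn_seam_of_entrywise {Φ : Type} {dat : Φ → lp (fun _ : E₁ => ℂ) ∞ × BoundedContinuousFunction E₂ ℂ}
    {s : Wn → Φ} {α₂ B₁ B₂ : ℝ}
    (hop : ∀ e, DifferentiableOn ℂ (fun v => (dat (s v)).1 e) (ball 0 α₂))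
    (hB₁ : 0 ≤ B₁) (hopB : ∀ v ∈ ball (0 : Wn) α₂, ∀ e, ‖(dat (s v)).1 e‖ ≤ B₁)
    (hhist : ∀ a, DifferentiableOn ℂ (fun v => (dat (s v)).2 a) (ball 0 α₂))
    (hB₂ : 0 ≤ B₂) (hhistB : ∀ v ∈ ball (0 : Wn) α₂, ∀ a, ‖(dat (s v)).2 a‖ ≤ B₂) :
    DifferentiableOn ℂ (fun v => dat (s v)) (ball 0 α₂) :=
  (differentiableOn_of_forall_coord_le (G := fun v => (dat (s v)).1) isOpen_ball hop hB₁ hopB).prodMk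
    (differentiableOn_bcf_of_forall_coord_le (G := fun v => (dat (s v)).2) isOpen_ball hhist hB₂ hhistB)

end Seam

/-! ## §2 The ASSEMBLED operator datum is holomorphic when its raw entries are (row NE9's instancer currency) -/

section Assemble

open Summit.QuantumFields.BalabanUV.T4Continuum.B13OpDatum

variable {E₁ : Type*} (F : Format E₁)
variable {Wn : Type*} [NormedAddCommGroup Wn] [NormedSpace ℂ Wn]

/-- **`assemble` OF ENTRYWISE-HOLOMORPHIC RAW KERNELS IN A UNIFORM FORMAT BALL IS HOLOMORPHIC INTO `OpDatum`.**  If the RAW kernel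
`K v : E₁ → ℂ` depends on a parameter `v` of an open set `S` so that every entry `v ↦ K v e` is ℂ-differentiable on `S` and every
`K v` lies in the format ball of radius `R` (`InFormat F (K v) R` — the one-run (1.7)∕(2.16)-type bound holding UNIFORMLY on the complex
parameter domain, [B9] Thm 3.4's currency), then the assembled normalised datum `v ↦ assemble F (K v) : OpDatum E₁` is ℂ-differentiable on
`S` — the item «analyticity of the ASSEMBLED `OpDatum`-valued map» of `Support/NE9ChartFaceOperatorHolo` (header, NOT HERE), by Mujica 1986
Ex. 8.H in the tree's form (`HolomorphicIntoLinfty.differentiableOn_of_forall_coord`). [cite: Mujica1986, Ex. 8.H] -/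
theorem differentiableOn_assemble_of_entrywise {K : Wn → E₁ → ℂ} {S : Set Wn} (hS : IsOpen S) {R : ℝ} (hR : 0 ≤ R)
    (hK : ∀ e, DifferentiableOn ℂ (fun v => K v e) S) (hIn : ∀ v ∈ S, InFormat F (K v) R) :
    DifferentiableOn ℂ (fun v => assemble F (K v)) S := by
  refine differentiableOn_of_forall_coord hS (fun e => ?_) fun v hv => norm_assemble_le (hIn v hv) hR
  refine ((hK e).mul_const ((F.wt e : ℂ)⁻¹)).congr fun v hv => ?_
  rw [assemble_apply (hIn v hv).formatBounded e, div_eq_mul_inv]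

end Assemble

/-! ## §3 Residual (r4) in kernel at the FORMAT level: an unweighted two-run rate interpolates against the weighted one-run bounds -/

section Interpolate

open Summit.QuantumFields.BalabanUV.T4Continuum.B13OpDatum

variable {E₁ : Type*} (F : Format E₁)

/-- `min a b ≤ a^{1−s} b^{s}` for `0 ≤ a, b` and `s ∈ [0, 1]`. [folklore] -/
private theorem min_le_rpow_mul_rpow {a b s : ℝ} (ha : 0 ≤ a) (hb : 0 ≤ b) (hs0 : 0 ≤ s) (hs1 : s ≤ 1) :
    min a b ≤ a ^ (1 - s) * b ^ s := by
  have hm : 0 ≤ min a b := le_min ha hb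
  calc min a b = (min a b) ^ ((1 - s) + s) := by rw [sub_add_cancel, Real.rpow_one]
    _ = (min a b) ^ (1 - s) * (min a b) ^ s := Real.rpow_add' hm (by norm_num)
    _ ≤ a ^ (1 - s) * b ^ s :=
        mul_le_mul (Real.rpow_le_rpow hm (min_le_left a b) (by linarith))
          (Real.rpow_le_rpow hm (min_le_right a b) hs0) (Real.rpow_nonneg hm _) (Real.rpow_nonneg ha _)

/-- **INTERPOLATED TWO-RUN FORMAT BOUND (residual (r4) of `HOME/ne/NE5.md` §7, harmless IN KIND).**  If two raw kernels differ ENTRYWISE by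
at most `r` UNIFORMLY (what an operator-norm ∕ unweighted two-spacing rate of row NE2 gives, `r = C·θ^j`) and BOTH lie in the weighted
format ball of radius `R` (the ε-uniform one-run (1.7)∕(2.16)-type bounds each run enjoys), then for every `s ∈ [0, 1]` their difference lies
in the ball of radius `r^{1−s}·(2R)^{s}` of ANY format whose weights dominate the `s`-th powers `(wt e)^s` of the original weights — i.e. a
two-run rate `θ^{(1−s)j}` (still geometric) in a format with the WEAKER decay `e^{−sδ d}` (Lemma 3's proof then asks a larger cube size M,
printed kind: [II] p. 16 «e^{−⅓δ₀M}e^{16κ₁} < 1»).  Pure `min a b ≤ a^{1−s}b^{s}`. [folklore] -/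
theorem inFormat_sub_interpolate {K K' : E₁ → ℂ} {r R s : ℝ} (hr : 0 ≤ r) (hR : 0 ≤ R) (hs0 : 0 ≤ s) (hs1 : s ≤ 1)
    (hKK' : ∀ e, ‖K e - K' e‖ ≤ r) (hK : InFormat F K R) (hK' : InFormat F K' R)
    (F' : Format E₁) (hF' : ∀ e, F.wt e ^ s ≤ F'.wt e) :
    InFormat F' (K - K') (r ^ (1 - s) * (2 * R) ^ s) := by
  intro e
  have hw : 0 < F.wt e := F.wt_pos e
  have h2 : ‖K e - K' e‖ ≤ 2 * R * F.wt e :=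
    calc ‖K e - K' e‖ ≤ ‖K e‖ + ‖K' e‖ := norm_sub_le _ _
      _ ≤ R * F.wt e + R * F.wt e := add_le_add (hK e) (hK' e)
      _ = 2 * R * F.wt e := by ring
  have hmin : ‖K e - K' e‖ ≤ min r (2 * R * F.wt e) := le_min (hKK' e) h2
  have key := min_le_rpow_mul_rpow hr (by positivity : 0 ≤ 2 * R * F.wt e) hs0 hs1
  have hsplit : (2 * R * F.wt e) ^ s = (2 * R) ^ s * F.wt e ^ s := Real.mul_rpow (by positivity) hw.le
  calc ‖(K - K') e‖ = ‖K e - K' e‖ := rfl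
    _ ≤ r ^ (1 - s) * (2 * R * F.wt e) ^ s := hmin.trans key
    _ = r ^ (1 - s) * (2 * R) ^ s * F.wt e ^ s := by rw [hsplit, mul_assoc]
    _ ≤ r ^ (1 - s) * (2 * R) ^ s * F'.wt e :=
        mul_le_mul_of_nonneg_left (hF' e) (by positivity)

/-- **In particular in the `OpDatum` norm**: the assembled difference has norm `≤ r^{1−s}(2R)^s` in the dominating format `F'`
(`norm_assemble_sub_le`). [folklore] -/
theorem norm_assemble_sub_le_interpolate {K K' : E₁ → ℂ} {r R s : ℝ} (hr : 0 ≤ r) (hR : 0 ≤ R) (hs0 : 0 ≤ s) (hs1 : s ≤ 1)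
    (hKK' : ∀ e, ‖K e - K' e‖ ≤ r) (hK : InFormat F K R) (hK' : InFormat F K' R)
    (F' : Format E₁) (hF' : ∀ e, F.wt e ^ s ≤ F'.wt e) (hKb : FormatBounded F' K) (hK'b : FormatBounded F' K') :
    ‖assemble F' K - assemble F' K'‖ ≤ r ^ (1 - s) * (2 * R) ^ s :=
  norm_assemble_sub_le hKb hK'b (by positivity) fun e => inFormat_sub_interpolate F hr hR hs0 hs1 hKK' hK hK' F' hF' e

end Interpolate

end Summit.QuantumFields.BalabanUV.T4Continuum.Spine.NE5
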